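import Summits.QuantumFields.YangMills.Theorems.SoloBlindSchemeTorusPinning
import Summits.QuantumFields.YangMills.Theorems.SoloBlindSmearedSpecies
import HarnessLib

/-!
# The gap constant of a spatially smeared field (solo-QuantumFields-blind, rung D20)

## … is the `ℓ¹` norm of the smearing, squared: smeared witnesses are pinned like plain ones

`Summit.QuantumFields.YangMills` couples the continuum datum `T` to the lattice through smeared
fields `Φ_i(f)(U) = a⁴ ∑ₓ f(a x) · c_i · s_i(τₓ U)` (`smearedLatticeField`), and asks for the
lattice
gap `HasLatticeMassGap r sch Δ` with a constant `C = C(A, B)` that may depend on the PAIR of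
observables.  Rung D19 (`SoloBlindSchemeTorusPinning`) pinned `Δ` by the physical correlation
length of any time-zero spatial witness family `A_k` whose autocorrelator keeps a two-time ratio
floor on the scheme's own tori — unconditionally in SLOPE, and in VALUE (`Δ ≤ -log ϑ/τ`) as soon as
the gap constants `C_k` of the pairs `(A_k, A_k)` are `e^{o(a_k L_k)}` relative to the floor.  For a
witness family made of RENORMALISED, SMEARED copies of one species the constants `C_k` are not at
our disposal — `HasLatticeMassGap` hides them.  This file computes them.

* (rung D20a, `SoloBlindSmearedSpecies`) `smearSpecies O s h z = ∑ᵢ hᵢ O(· + zᵢ)` is again a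
  `YMSpecies`, time-zero spatial when `O` is and the `zᵢ` are spatial; the statement's correlator
  is BILINEAR (`latticeConnectedCorr_linCombSpecies`) and TRANSLATION INVARIANT
  (`latticeConnectedCorr_comp_configShift`).
* `sq_latticeConnectedCorr_translateSpecies_le`: if `c_{O,O}(S; n) ≤ K θⁿ` (`n ≤ S`) then
  `θ · c_{O,O(·+w)}(S; n)² ≤ K² θ^{2n}` for every spatial `w` — reflection positivity, through the
  mixed Schwarz inequality of rung D8 (`timeTwoPtMixedSeq_sq_le_of_geometric`).
* `abs_latticeConnectedCorr_smearSpecies_le`: hence `|c_{H,H}(S; n)| ≤ (∑ᵢ|hᵢ|)² K θⁿ/θ` for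
  `H = ∑ᵢ hᵢ O(· + zᵢ)`: the gap constant of the pair `(H, H)` is at most `(∑|hᵢ|)²/θ` times that
  of the single pair `(O, O)` — for the statement's smearing, `(c_k a_k ‖f‖_{L¹})² e^{Δ a_k}` up to
  Riemann-sum error.
* `latticeMassGap_le_of_smearedSchemeToriFloor`: consequently D19's value pinning holds for
  smeared witness families with the tameness hypothesis made EXPLICIT and species-level:
  `Δ ≤ -log ϑ/τ` as soon as the floor value outgrows `(∑ᵢ|h_{k,i}|)²` sub-exponentially in
  `a_k L_k`; `gap_le_add_of_schemeToriFloor` is the rate form `Δ ≤ -log ϑ/τ + ϱ` of D19.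

What this says about the statement (prose: this unit's `paper/obstruction.md` §1 (R2′), referee
note 61): the only freedom a scheme has to escape the pinning of `Δ` by the physical mass of a
reflection-positive channel is the species renormalisation `c_k`, and it escapes exactly when
`log c_k ≳ a_k L_k`, i.e. (for field-strength smearings, `c_k ≍ a_k^{-4}`) exactly in the one-torus
vacuity regime `a_k L_k = O(log a_k⁻¹)` flagged in the docstring of `HasLatticeMassGap` itself.

References: K. Osterwalder, E. Seiler, Ann. Phys. 110 (1978) 440, §2 (reflection positivity,
transfer matrix); E. Seiler, LNP 159 (1982) Ch. 2; J. Glimm, A. Jaffe, *Quantum Physics* (1987)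
§6.1, §19; translation invariance of the torus Wilson state: folklore (`LatticeGaugeProofs`).
[the typed statements and their assembly are this unit's]
-/

open MeasureTheory Filter Topology
open Literature.MathematicalPhysics.QuantumFieldTheory Literature.MathematicalPhysics.QuantumLattice

noncomputable section

namespace Summit.QuantumFields.YangMills.Theorems.SoloBlind

variable {G : Type} [Group G] [TopologicalSpace G] [IsTopologicalGroup G] [CompactSpace G]
  [MeasurableSpace G] [BorelSpace G]

/-! ### The mixed correlator of a species and its spatial translate -/

/-- From `θ·x² ≤ K²·θ^{2n}` (`0 < θ ≤ 1`, `K ≥ 0`): `|x| ≤ K θⁿ / θ`. -/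
private theorem abs_le_of_mul_sq_le {θ x K : ℝ} (hθ : 0 < θ) (hθ1 : θ ≤ 1) (hK : 0 ≤ K) {n : ℕ}
    (h : θ * x ^ 2 ≤ K * K * θ ^ (2 * n)) : |x| ≤ K * θ ^ n / θ := by
  have hKn : 0 ≤ K * θ ^ n := mul_nonneg hK (pow_nonneg hθ.le _)
  have hsq : (θ * x) ^ 2 ≤ (K * θ ^ n) ^ 2 := by
    have h1 : (θ * x) ^ 2 = θ * (θ * x ^ 2) := by ring
    have h2 : (K * θ ^ n) ^ 2 = K * K * θ ^ (2 * n) := by ring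
    rw [h1, h2]
    calc θ * (θ * x ^ 2) ≤ 1 * (θ * x ^ 2) :=
          mul_le_mul_of_nonneg_right hθ1 (mul_nonneg hθ.le (sq_nonneg _))
      _ = θ * x ^ 2 := one_mul _
      _ ≤ K * K * θ ^ (2 * n) := h
  have habs : |θ * x| ≤ K * θ ^ n := abs_le_of_sq_le_sq hsq hKn
  rw [abs_mul, abs_of_pos hθ] at habs
  rw [le_div_iff₀ hθ, mul_comm]
  exact habs

/-- **Mixed bound.**  If the autocorrelator of a time-zero spatial species `O` on the odd torus
`(ℤ/(2S+1))⁴` is dominated by a geometric sequence, `c_{O,O}(S; n) ≤ K θⁿ` for `n ≤ S`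
(`0 < θ ≤ 1`), then so is its correlator with every SPATIAL translate `O(· + w)`, with the SAME
constant up to one factor `θ^{-1/2}`: `θ · c_{O,O(·+w)}(S; n)² ≤ K² θ^{2n}` (`n ≤ S`) — reflection
positivity (the mixed Schwarz inequality `timeTwoPtMixedSeq_sq_le_of_geometric`) and translation
invariance (`c_{O(·+w),O(·+w)} = c_{O,O}`). [this unit's] -/
theorem sq_latticeConnectedCorr_translateSpecies_le {N : ℕ} (ρ : G →* Matrix (Fin N) (Fin N) ℂ)
    (hρ : Continuous ρ) {β : ℝ} (hβ : 0 ≤ β) {S : ℕ} (hS : 1 ≤ S) (O : YMSpecies G)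
    (hO : IsTimeZeroSpatial O) {w : Literature.Probability.LatticeModels.Site 4} (hw : w 0 = 0)
    {θ K : ℝ} (hθ : 0 < θ) (hθ1 : θ ≤ 1)
    (hK : ∀ n : ℕ, n ≤ S → latticeConnectedCorr ρ β (2 * S + 1) O.F O.F n ≤ K * θ ^ n) {n : ℕ}
    (hn : n ≤ S) :
    θ * latticeConnectedCorr ρ β (2 * S + 1) O.F (translateSpecies O w).F n ^ 2 ≤
      K * K * θ ^ (2 * n) := by
  have hL : Odd (2 * S + 1) := ⟨S, rfl⟩
  have hL3 : 3 ≤ 2 * S + 1 := by omega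
  obtain ⟨hFm, hFb, hF0⟩ := centred_toTorusObservable_hyps ρ β S O hO
  obtain ⟨hGm, hGb, hG0⟩ := centred_toTorusObservable_hyps ρ β S (translateSpecies O w)
    (isTimeZeroSpatial_translateSpecies hO hw)
  rw [latticeConnectedCorr_eq_timeTwoPtMixedSeq ρ hρ β S O (translateSpecies O w) n]
  refine timeTwoPtMixedSeq_sq_le_of_geometric ρ hL hL3 hρ hβ hFm hFb hF0 hGm hGb hG0 hθ hθ1
    ?_ ?_ (by omega)
  · intro m hm
    rw [← latticeConnectedCorr_eq_timeTwoPtSeq ρ hρ β S O m]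
    exact hK m (by omega)
  · intro m hm
    rw [← latticeConnectedCorr_eq_timeTwoPtSeq ρ hρ β S (translateSpecies O w) m,
      latticeConnectedCorr_translateSpecies_self]
    exact hK m (by omega)

/-- The same in absolute-value form: `|c_{O,O(·+w)}(S; n)| ≤ K θⁿ / θ`. -/
theorem abs_latticeConnectedCorr_translateSpecies_le {N : ℕ} (ρ : G →* Matrix (Fin N) (Fin N) ℂ)
    (hρ : Continuous ρ) {β : ℝ} (hβ : 0 ≤ β) {S : ℕ} (hS : 1 ≤ S) (O : YMSpecies G)
    (hO : IsTimeZeroSpatial O) {w : Literature.Probability.LatticeModels.Site 4} (hw : w 0 = 0)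
    {θ K : ℝ} (hθ : 0 < θ) (hθ1 : θ ≤ 1)
    (hK : ∀ n : ℕ, n ≤ S → latticeConnectedCorr ρ β (2 * S + 1) O.F O.F n ≤ K * θ ^ n) {n : ℕ}
    (hn : n ≤ S) :
    |latticeConnectedCorr ρ β (2 * S + 1) O.F (translateSpecies O w).F n| ≤ K * θ ^ n / θ := by
  have hK0 : 0 ≤ K := by
    have h0 := hK 0 (Nat.zero_le _)
    rw [pow_zero, mul_one] at h0
    exact (latticeConnectedCorr_self_nonneg ρ hρ hβ hS O hO 0).trans h0
  exact abs_le_of_mul_sq_le hθ hθ1 hK0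
    (sq_latticeConnectedCorr_translateSpecies_le ρ hρ hβ hS O hO hw hθ hθ1 hK hn)

/-! ### The gap constant of the smeared species -/

/-- **The gap constant of a smeared field is controlled by the `ℓ¹` norm of the smearing.**
If `c_{O,O}(S; n) ≤ K θⁿ` for all `n ≤ S` (`O` time-zero spatial, `0 < θ ≤ 1`, `β ≥ 0`, `S ≥ 1`),
then for every SPATIAL smearing `H = ∑ᵢ hᵢ O(· + zᵢ)`:
`|c_{H,H}(S; n)| ≤ (∑ᵢ |hᵢ|)² · K θⁿ / θ` for all `n ≤ S` — the pair-dependent constant of the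
statement's `HasLatticeMassGap`, for the pair `(H, H)`, is at most `(∑|hᵢ|)²/θ` times the constant
of the single pair `(O, O)` (bilinearity + translation invariance + the RP mixed Schwarz bound).
[this unit's] -/
theorem abs_latticeConnectedCorr_smearSpecies_le {N : ℕ} (ρ : G →* Matrix (Fin N) (Fin N) ℂ)
    (hρ : Continuous ρ) {β : ℝ} (hβ : 0 ≤ β) {S : ℕ} (hS : 1 ≤ S) (O : YMSpecies G)
    (hO : IsTimeZeroSpatial O) {ι : Type*} (s : Finset ι) (h : ι → ℝ)
    {z : ι → Literature.Probability.LatticeModels.Site 4}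
    (hz : ∀ i ∈ s, z i 0 = 0) {θ K : ℝ} (hθ : 0 < θ) (hθ1 : θ ≤ 1)
    (hK : ∀ n : ℕ, n ≤ S → latticeConnectedCorr ρ β (2 * S + 1) O.F O.F n ≤ K * θ ^ n) {n : ℕ}
    (hn : n ≤ S) :
    |latticeConnectedCorr ρ β (2 * S + 1) (smearSpecies O s h z).F (smearSpecies O s h z).F n| ≤
      (∑ i ∈ s, |h i|) ^ 2 * (K * θ ^ n / θ) := by
  have hB : ∀ i ∈ s, ∀ j ∈ s, |latticeConnectedCorr ρ β (2 * S + 1)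
      (translateSpecies O (z i)).F (translateSpecies O (z j)).F n| ≤ K * θ ^ n / θ := by
    intro i hi j hj
    rw [latticeConnectedCorr_translateSpecies_translateSpecies]
    have hw : (z j - z i) 0 = 0 := by simp [hz i hi, hz j hj]
    exact abs_latticeConnectedCorr_translateSpecies_le ρ hρ hβ hS O hO hw hθ hθ1 hK hn
  unfold smearSpecies
  rw [latticeConnectedCorr_linCombSpecies ρ hρ β (2 * S + 1) s s h h _ _ n]
  calc |∑ i ∈ s, ∑ j ∈ s, h i * h j * latticeConnectedCorr ρ β (2 * S + 1)
          (translateSpecies O (z i)).F (translateSpecies O (z j)).F n|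
      ≤ ∑ i ∈ s, |∑ j ∈ s, h i * h j * latticeConnectedCorr ρ β (2 * S + 1)
          (translateSpecies O (z i)).F (translateSpecies O (z j)).F n| :=
        Finset.abs_sum_le_sum_abs _ _
    _ ≤ ∑ i ∈ s, ∑ j ∈ s, |h i * h j * latticeConnectedCorr ρ β (2 * S + 1)
          (translateSpecies O (z i)).F (translateSpecies O (z j)).F n| :=
        Finset.sum_le_sum fun i _ => Finset.abs_sum_le_sum_abs _ _
    _ ≤ ∑ i ∈ s, ∑ j ∈ s, |h i| * |h j| * (K * θ ^ n / θ) :=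
        Finset.sum_le_sum fun i hi => Finset.sum_le_sum fun j hj => by
          rw [abs_mul, abs_mul]
          exact mul_le_mul_of_nonneg_left (hB i hi j hj) (by positivity)
    _ = (∑ i ∈ s, |h i|) ^ 2 * (K * θ ^ n / θ) := by
        rw [sq, Finset.sum_mul_sum, Finset.sum_mul]
        refine Finset.sum_congr rfl fun i _ => ?_
        rw [Finset.sum_mul]

/-! ### Consequence for the statement: smeared witnesses do not escape the pinning -/

/-- `e^{-Δ a n} = (e^{-Δ a})ⁿ`. -/
private theorem exp_neg_mul_nat (Δ a : ℝ) (n : ℕ) :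
    Real.exp (-(Δ * (a * n))) = Real.exp (-(Δ * a)) ^ n := by
  rw [← Real.exp_nat_mul]; ring_nf

/-- **Smeared witnesses are pinned like plain ones.**  Let `O` be ONE time-zero spatial species and
let the witness family be spatial smearings `H_k = ∑_{i ∈ s_k} h_{k,i} O(· + z_{k,i})` of it (the
statement's smeared fields at fixed time are of this form, with `h_{k,i} = c_k a_k⁴ f(a_k z)`).
If `HasLatticeMassGap r sch Δ` holds (only its clause for the single pair `(O, O)` on the scheme's
own tori is used) and the autocorrelators of the `H_k` on the scheme's own tori have a two-time
ratio floor `(τ, ϑ)` (`HasRatioFloorOnSchemeTori`-type data `n₁, n₂, t₂`) whose value outgrows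
`(∑ᵢ |h_{k,i}|)²` sub-exponentially in `a_k L_k` — `M (∑ᵢ|h_{k,i}|)² ≤ c_k(n₂) e^{ε a_k L_k}`
eventually, for every `M` and every `ε > 0` — then `Δ ≤ -log ϑ / τ`.  The species renormalisation
hidden in the pair-dependent constant of `HasLatticeMassGap` is thereby made EXPLICIT: it is the
`ℓ¹` norm of the smearing, squared. [this unit's] -/
theorem latticeMassGap_le_of_smearedSchemeToriFloor (r : LatticeRep G)
    {sch : SpeciesScheme (YMSpecies G)} (hw : sch.HasWeakCouplingLimit) {Δ : ℝ}
    (hgap : HasLatticeMassGap r sch Δ) (O : YMSpecies G) (hO : IsTimeZeroSpatial O) {ι : Type*}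
    (s : ℕ → Finset ι) (h : ℕ → ι → ℝ) (z : ℕ → ι → Literature.Probability.LatticeModels.Site 4)
    (hz : ∀ k, ∀ i ∈ s k, z k i 0 = 0)
    {τ ϑ : ℝ} (hτ : 0 < τ) (hϑ : 0 < ϑ) (hϑ1 : ϑ ≤ 1) {n₁ n₂ : ℕ → ℕ} {t₂ : ℝ}
    (h12 : ∀ k, n₁ k < n₂ k) (hsep : ∀ k, τ ≤ sch.a k * ((n₂ k - n₁ k : ℕ) : ℝ))
    (ht₂ : ∀ k, sch.a k * n₂ k ≤ t₂)
    (hfl : ∀ᶠ k in atTop,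
      0 < schemeCorr r sch (fun k => smearSpecies O (s k) (h k) (z k)) k (n₂ k) ∧
      ϑ * schemeCorr r sch (fun k => smearSpecies O (s k) (h k) (z k)) k (n₁ k) ≤
        schemeCorr r sch (fun k => smearSpecies O (s k) (h k) (z k)) k (n₂ k))
    (hgrow : ∀ M ε : ℝ, 0 < ε → ∀ᶠ k in atTop, M * (∑ i ∈ s k, |h k i|) ^ 2 ≤
      schemeCorr r sch (fun k => smearSpecies O (s k) (h k) (z k)) k (n₂ k) *
        Real.exp (ε * (sch.a k * sch.L k))) :
    Δ ≤ -Real.log ϑ / τ := by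
  have hκ0 : 0 ≤ -Real.log ϑ / τ := div_nonneg (neg_nonneg.mpr (Real.log_nonpos hϑ.le hϑ1)) hτ.le
  rcases lt_or_ge Δ 0 with hΔ | hΔ
  · exact hΔ.le.trans hκ0
  have hρ := r.continuous
  set A : ℕ → YMSpecies G := fun k => smearSpecies O (s k) (h k) (z k) with hAdef
  have hA : ∀ k, IsTimeZeroSpatial (A k) := fun k => isTimeZeroSpatial_smearSpecies hO (h k) (hz k)
  obtain ⟨C, hC⟩ := hgap O O
  have hβ0 : ∀ᶠ k in atTop, 0 ≤ sch.β k := hw.eventually_ge_atTop 0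
  -- the smeared gap constant on the scheme's own tori
  have hup : ∀ᶠ k in atTop, schemeCorr r sch A k (sch.L k) ≤
      C * Real.exp Δ * (∑ i ∈ s k, |h k i|) ^ 2 * Real.exp (-(Δ * (sch.a k * sch.L k))) := by
    filter_upwards [hC, hβ0, eventually_one_le_L sch, eventually_a_le_one sch] with k hCk hβk
      hLk hak
    have ha := sch.a_pos k
    set θ : ℝ := Real.exp (-(Δ * sch.a k)) with hθ
    have hθ0 : 0 < θ := Real.exp_pos _
    have hθ1 : θ ≤ 1 := Real.exp_le_one_iff.mpr (neg_nonpos.mpr (mul_nonneg hΔ ha.le))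
    have hθinv : θ⁻¹ ≤ Real.exp Δ := by
      rw [hθ, ← Real.exp_neg, neg_neg, Real.exp_le_exp]
      calc Δ * sch.a k ≤ Δ * 1 := mul_le_mul_of_nonneg_left hak hΔ
        _ = Δ := mul_one _
    have hK : ∀ n : ℕ, n ≤ sch.L k →
        latticeConnectedCorr r.ρ (sch.β k) (2 * sch.L k + 1) O.F O.F n ≤ C * θ ^ n := by
      intro n hn
      have h := hCk (sch.L k) le_rfl n hn
      rw [exp_neg_mul_nat] at h
      exact (le_abs_self _).trans h
    have hmain := abs_latticeConnectedCorr_smearSpecies_le r.ρ hρ hβk hLk O hO (s k) (h k) (hz k)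
      hθ0 hθ1 hK (le_refl (sch.L k))
    have hC0 : 0 ≤ C := by
      have h0 := hK 0 (Nat.zero_le _)
      rw [pow_zero, mul_one] at h0
      exact (latticeConnectedCorr_self_nonneg r.ρ hρ hβk hLk O hO 0).trans h0
    calc schemeCorr r sch A k (sch.L k)
        ≤ |schemeCorr r sch A k (sch.L k)| := le_abs_self _
      _ ≤ (∑ i ∈ s k, |h k i|) ^ 2 * (C * θ ^ sch.L k / θ) := hmain
      _ = (∑ i ∈ s k, |h k i|) ^ 2 * (C * θ⁻¹) * θ ^ sch.L k := by rw [div_eq_mul_inv]; ring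
      _ ≤ (∑ i ∈ s k, |h k i|) ^ 2 * (C * Real.exp Δ) * θ ^ sch.L k := by
          gcongr
      _ = C * Real.exp Δ * (∑ i ∈ s k, |h k i|) ^ 2 * Real.exp (-(Δ * (sch.a k * sch.L k))) := by
          rw [hθ, ← exp_neg_mul_nat]; ring
  have htame : ∀ ε : ℝ, 0 < ε → ∀ᶠ k in atTop, C * Real.exp Δ * (∑ i ∈ s k, |h k i|) ^ 2 ≤
      schemeCorr r sch A k (n₂ k) * Real.exp (ε * (sch.a k * sch.L k)) :=
    fun ε hε => hgrow (C * Real.exp Δ) ε hε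
  exact gap_le_of_schemeToriFloor r hw A hA hτ hϑ hϑ1 h12 hsep ht₂ hfl hup htame

/-- **Rate form of the scheme-torus pinning** (`gap_le_of_schemeToriFloor` with an exponential
allowance): if the ratio of the gap constant `C_k` to the floor VALUE `c_k(n₂)` grows at most like
`e^{ϱ a_k L_k}`, then `Δ ≤ -log ϑ / τ + ϱ`. [this unit's] -/
theorem gap_le_add_of_schemeToriFloor (r : LatticeRep G) {sch : SpeciesScheme (YMSpecies G)}
    (hw : sch.HasWeakCouplingLimit) (A : ℕ → YMSpecies G) (hA : ∀ k, IsTimeZeroSpatial (A k))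
    {τ ϑ : ℝ} (hτ : 0 < τ) (hϑ : 0 < ϑ) (hϑ1 : ϑ ≤ 1) {n₁ n₂ : ℕ → ℕ} {t₂ : ℝ}
    (h12 : ∀ k, n₁ k < n₂ k) (hsep : ∀ k, τ ≤ sch.a k * ((n₂ k - n₁ k : ℕ) : ℝ))
    (ht₂ : ∀ k, sch.a k * n₂ k ≤ t₂)
    (hfl : ∀ᶠ k in atTop, 0 < schemeCorr r sch A k (n₂ k) ∧
      ϑ * schemeCorr r sch A k (n₁ k) ≤ schemeCorr r sch A k (n₂ k))
    {Δ ϱ : ℝ} {C : ℕ → ℝ}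
    (hup : ∀ᶠ k in atTop, schemeCorr r sch A k (sch.L k) ≤
      C k * Real.exp (-(Δ * (sch.a k * sch.L k))))
    (hrate : ∀ᶠ k in atTop,
      C k ≤ schemeCorr r sch A k (n₂ k) * Real.exp (ϱ * (sch.a k * sch.L k))) :
    Δ ≤ -Real.log ϑ / τ + ϱ := by
  suffices h : Δ - ϱ ≤ -Real.log ϑ / τ by linarith
  refine gap_le_of_schemeToriFloor r hw A hA hτ hϑ hϑ1 h12 hsep ht₂ hfl
    (C := fun k => C k * Real.exp (-(ϱ * (sch.a k * sch.L k)))) ?_ ?_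
  · filter_upwards [hup] with k hk
    calc schemeCorr r sch A k (sch.L k) ≤ C k * Real.exp (-(Δ * (sch.a k * sch.L k))) := hk
      _ = C k * Real.exp (-(ϱ * (sch.a k * sch.L k))) *
            Real.exp (-((Δ - ϱ) * (sch.a k * sch.L k))) := by
          rw [mul_assoc, ← Real.exp_add]; ring_nf
  · intro ε hε
    filter_upwards [hrate, hfl] with k hk hflk
    have haL : 0 ≤ sch.a k * sch.L k := mul_nonneg (sch.a_pos k).le (Nat.cast_nonneg _)
    calc C k * Real.exp (-(ϱ * (sch.a k * sch.L k)))
        ≤ schemeCorr r sch A k (n₂ k) * Real.exp (ϱ * (sch.a k * sch.L k)) *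
            Real.exp (-(ϱ * (sch.a k * sch.L k))) :=
          mul_le_mul_of_nonneg_right hk (Real.exp_pos _).le
      _ = schemeCorr r sch A k (n₂ k) := by
          rw [mul_assoc, ← Real.exp_add, add_neg_cancel, Real.exp_zero, mul_one]
      _ ≤ schemeCorr r sch A k (n₂ k) * Real.exp (ε * (sch.a k * sch.L k)) :=
          le_mul_of_one_le_right hflk.1.le (Real.one_le_exp (mul_nonneg hε.le haL))

end Summit.QuantumFields.YangMills.Theorems.SoloBlind

end
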